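import Mathlib
import Summits.CriticalPhenomena.CardyFormulaZ2.Theorems.CardyFlipRussoSquareFromVoronoiHubDecimateForward
import Summits.CriticalPhenomena.CardyFormulaZ2.Theorems.CardyFlipRussoSquareFromVoronoiHubFaithfulPart8
import Literature.Probability.Percolation.SitePaths
import HarnessLib

/-!
# Squeeze, upper inclusion — stub `stub_crudeUpper` of line `centre-decimation`
# for crux `SquareFromVoronoiHub` (stmt-CriticalPhenomena-6434, route CardyFlipRusso, sub-problem CardyFormulaZ2)

We prove the upper half of the squeeze of the crux's crude crossing event between two `G_s`
connection events whose endpoints are `ℤ²`-SITES: if `0 < δ` and `4δ < dist (arc 0, arc 2)`, then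
`crudeCrossing R δ ⊆ gsConn (siteWindow R δ) (faceWindow R δ) (nearArc R 0 3 δ) (nearArc R 2 3 δ)`.

Proof (elementary path surgery).  A crude crossing is an open `G_s`-path inside the window
`{y | δ·zGs y ∈ Ω} = inl '' siteWindow ∪ inr '' faceWindow` from a vertex `u` within `2δ` of the arc
`(ab)` to a vertex `v` within `2δ` of `(cd)`; `u ≠ v` since otherwise the two (compact) arcs would
be within `4δ` of each other.  If an endpoint is a face centre, it is therefore not alone on the
path, and its path-neighbour is a site (there are no centre–centre edges) at distance `≤ δ`
(landed `VoronoiBlocks.Faithful.dist_le_of_Gs_adj`), hence within `3δ` of the arc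
(`Metric.infDist_le_infDist_add_dist`).  Trimming both ends gives the site-to-site connection.
(Beffara 2008, §5.1, the lattice `G_s`; Smirnov 2001, §2, crude crossing events.)
-/

noncomputable section
open scoped Topology MeasureTheory
open Filter Set MeasureTheory
open Literature.Probability.RandomPlanarGeometry (ConformalRectangle)
open Literature.Probability.Percolation (SiteConfig sitePercolation siteConnIn siteOpenGraph half
  centredSquareGraph centredSquareEmbedding)
open Summit.CriticalPhenomena.CardyFormulaZ2.Cruxes.SquareFromVoronoiHub.VoronoiBlocks (zGs Gs crudeCrossing)

namespace Summit.CriticalPhenomena.CardyFormulaZ2.Cruxes.SquareFromVoronoiHub.CentreDecimation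

namespace stub_crudeUpperAux

open Literature.Probability.Percolation
open stub_decimateForwardAux

/-! ### The window dictionary -/

/-- The vertex window of the crux splits into the site window and the face window. [folklore] -/
theorem window_eq (R : ConformalRectangle) (δ : ℝ) :
    {y : (ℤ × ℤ) ⊕ (ℤ × ℤ) | (δ : ℂ) * zGs y ∈ R.carrier} =
      Sum.inl '' siteWindow R δ ∪ Sum.inr '' faceWindow R δ := by
  ext y
  rcases y with x | f
  · simp [siteWindow]
  · simp [faceWindow]

/-! ### Trimming a centre endpoint -/

/-- **Centre start.**  A non-trivial `G_s`-path inside `A` starting at a face centre within `2δ`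
of a set `S` passes, at its second vertex, through a SITE within `3δ` of `S`, from which the rest
of the path continues. [folklore] -/
theorem centre_head {S : Set ℂ} {δ : ℝ} (hδ : 0 ≤ δ) {A : Set ((ℤ × ℤ) ⊕ (ℤ × ℤ))}
    {f : ℤ × ℤ} {v : (ℤ × ℤ) ⊕ (ℤ × ℤ)}
    (hu : Metric.infDist ((δ : ℂ) * zGs (Sum.inr f)) S ≤ 2 * δ)
    (h : PathIn Gs A (Sum.inr f) v) (hne : v ≠ Sum.inr f) :
    ∃ x : ℤ × ℤ, Metric.infDist ((δ : ℂ) * zGs (Sum.inl x)) S ≤ 3 * δ ∧ PathIn Gs A (Sum.inl x) v := by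
  obtain ⟨-, hp⟩ := h
  rcases hp.cases_head with h0 | ⟨w, ⟨hadj, hwA⟩, hwv⟩
  · exact absurd h0.symm hne
  · cases w with
    | inr g => exact absurd hadj not_gs_adj_inr_inr
    | inl x =>
      refine ⟨x, ?_, hwA, hwv⟩
      calc Metric.infDist ((δ : ℂ) * zGs (Sum.inl x)) S
          ≤ Metric.infDist ((δ : ℂ) * zGs (Sum.inr f)) S +
              dist ((δ : ℂ) * zGs (Sum.inl x)) ((δ : ℂ) * zGs (Sum.inr f)) :=
            Metric.infDist_le_infDist_add_dist
        _ ≤ 2 * δ + δ := add_le_add hu (VoronoiBlocks.Faithful.dist_le_of_Gs_adj hδ hadj.symm)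
        _ = 3 * δ := by ring

/-- **Trimming the start.**  A `G_s`-path inside `A` starting at a vertex `u` within `2δ` of `S`,
which is non-trivial if `u` is a face centre, contains a SITE within `3δ` of `S` from which the
rest of the path continues (the start itself if `u` is a site). [folklore] -/
theorem site_head {S : Set ℂ} {δ : ℝ} (hδ : 0 ≤ δ) {A : Set ((ℤ × ℤ) ⊕ (ℤ × ℤ))}
    {u v : (ℤ × ℤ) ⊕ (ℤ × ℤ)}
    (hu : Metric.infDist ((δ : ℂ) * zGs u) S ≤ 2 * δ)
    (h : PathIn Gs A u v) (hne : ∀ f : ℤ × ℤ, u = Sum.inr f → v ≠ Sum.inr f) :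
    ∃ x : ℤ × ℤ, Metric.infDist ((δ : ℂ) * zGs (Sum.inl x)) S ≤ 3 * δ ∧ PathIn Gs A (Sum.inl x) v := by
  cases u with
  | inl x => exact ⟨x, hu.trans (by linarith), h⟩
  | inr f => exact centre_head hδ hu h (hne f rfl)

/-- **Distinct endpoints.**  A point cannot be within `2δ` of two nonempty compact sets that are
more than `4δ` apart. [folklore] -/
theorem false_of_near_both {S T : Set ℂ} (hS : IsCompact S) (hSn : S.Nonempty)
    (hT : IsCompact T) (hTn : T.Nonempty) {δ : ℝ} (hfar : ∀ a ∈ S, ∀ b ∈ T, 4 * δ < dist a b)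
    {p : ℂ} (hpS : Metric.infDist p S ≤ 2 * δ) (hpT : Metric.infDist p T ≤ 2 * δ) : False := by
  obtain ⟨a, ha, hda⟩ := hS.exists_infDist_eq_dist hSn p
  obtain ⟨b, hb, hdb⟩ := hT.exists_infDist_eq_dist hTn p
  have h4 := hfar a ha b hb
  have htri := dist_triangle_left a b p
  linarith

end stub_crudeUpperAux

/-- **stub_crudeUpper** (squeeze, upper inclusion): once `4δ` is smaller than the distance between
the arcs `(ab)` and `(cd)`, every crude `G_s` crossing contains an open `G_s` connection between
`ℤ²`-SITES within `3δ` of the two arcs (a centre endpoint within `2δ` of an arc is not alone on the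
path, and its path-neighbour is a corner at distance `δ/√2 ≤ δ`). -/
theorem stub_crudeUpper :
    ∀ (R : ConformalRectangle) {δ : ℝ}, 0 < δ →
      (∀ a ∈ R.arc 0, ∀ b ∈ R.arc 2, 4 * δ < dist a b) →
      crudeCrossing R δ ⊆
        gsConn (siteWindow R δ) (faceWindow R δ) (nearArc R 0 3 δ) (nearArc R 2 3 δ) := by
  intro R δ hδ hfar ω hω
  obtain ⟨u, v, hu, hv, h⟩ := hω
  rw [stub_crudeUpperAux.window_eq,
    Literature.Probability.Percolation.mem_siteConnIn_iff_pathIn] at h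
  have hne : u ≠ v := by
    rintro rfl
    exact stub_crudeUpperAux.false_of_near_both (R.isCompact_arc 0) ⟨_, R.pt_mem_arc_self 0⟩
      (R.isCompact_arc 2) ⟨_, R.pt_mem_arc_self 2⟩ hfar hu hv
  obtain ⟨x, hx, h₁⟩ := stub_crudeUpperAux.site_head hδ.le hu h
    (fun f hf hvf => hne (hf.trans hvf.symm))
  obtain ⟨y, hy, h₂⟩ := stub_crudeUpperAux.site_head hδ.le hv h₁.symm
    (fun _ _ => Sum.inl_ne_inr)
  exact ⟨x, hx, y, hy, Literature.Probability.Percolation.mem_siteConnIn_iff_pathIn.2 h₂.symm⟩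

end Summit.CriticalPhenomena.CardyFormulaZ2.Cruxes.SquareFromVoronoiHub.CentreDecimation
end
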